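import Summits.RiemannHypothesis.RiemannHypothesis.Theorems.HandoffLatticeUncertainty
import HarnessLib

/-!
# THEOREM U0, part 3/4 — measurability and integration lemmas for the witness

Handoff track (ROUTE 1′), prove-1 gen14, ATTEMPT-21; auxiliary to `HandoffLatticeUncertainty`:
measurability of the dilation sum (countably many pieces `⌊λ/u⌋ = N`) and of `F_η`; two `rpow`
identities; `∫_η^1 u^{-2} = η⁻¹ - 1`; integrability of bounded functions supported in an interval;
the monomial piece as an indicator and its integral `∫ m_{a,b} = (b^{1-ρ} - a^{1-ρ})/(1-ρ)`;
`|𝓕 F| ≤ ‖F‖₁`; and `‖F_η(x)‖² = x⁻¹` on `(η, 1/2)`. Nothing here bears on the truth of RH.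
-/

set_option linter.dupNamespace false

noncomputable section

open Complex MeasureTheory Set Filter Finset
open scoped Real FourierTransform

namespace Summit.RiemannHypothesis.RiemannHypothesis.Theorems

namespace LatticeUncertainty


/-! ## Measurability -/

variable {ρ : ℂ}

/-- The dilation sum of a measurable function is measurable in `u` (countably many pieces
`⌊λ/u⌋ = N`). -/
theorem measurable_dilationSum {Φ : ℝ → ℂ} (hΦ : Measurable Φ) (lam : ℝ) :
    Measurable (dilationSum lam Φ) := by
  have h : Measurable (fun p : ℕ × ℝ ↦ ∑ n ∈ Finset.Icc 1 p.1, Φ (n * p.2)) := by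
    apply measurable_from_prod_countable_right
    intro N
    change Measurable fun y : ℝ ↦ ∑ n ∈ Finset.Icc 1 N, Φ (n * y)
    refine Finset.measurable_sum _ fun n _ ↦ ?_
    exact hΦ.comp (measurable_const.mul measurable_id)
  exact h.comp ((Nat.measurable_floor.comp (measurable_const.div measurable_id)).prodMk
    measurable_id)

/-- The monomial piece is measurable. -/
theorem measurable_mono (ρ : ℂ) (a b : ℝ) : Measurable (mono ρ a b) := by
  unfold mono
  refine Measurable.ite ?_ ((Complex.measurable_ofReal).pow_const _) measurable_const
  exact measurableSet_Icc

/-- `G_η` is measurable. -/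
theorem measurable_G (ρ : ℂ) (η : ℝ) : Measurable (G ρ η) :=
  (measurable_mono ρ η 1).sub ((measurable_mono ρ (1 / 2) 1).const_mul _)

/-- `F_η` is measurable. -/
theorem measurable_F (ρ : ℂ) (η : ℝ) : Measurable (F ρ η) :=
  (measurable_G ρ η).add ((measurable_G ρ η).comp measurable_neg)


/-! ## Elementary integrals and integrability -/

variable {ρ : ℂ}

/-- `((η/2)^{-1/2})² = 2/η` and `(η^{1/2})² = η`. -/
theorem rpow_aux {η : ℝ} (hη : 0 < η) :
    ((η / 2) ^ (-(1 / 2 : ℝ))) ^ 2 = 2 / η ∧ (η ^ (1 / 2 : ℝ)) ^ 2 = η := by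
  constructor
  · rw [← Real.rpow_natCast, ← Real.rpow_mul (by positivity)]
    norm_num
    rw [Real.rpow_neg_one]; field_simp
  · rw [← Real.rpow_natCast, ← Real.rpow_mul hη.le]
    norm_num

/-- `∫_η^1 u^{-2} du = η⁻¹ - 1`. -/
theorem integral_zpow_neg_two {η : ℝ} (hη : 0 < η) (hη1 : η ≤ 1) :
    ∫ u in η..1, u ^ (-2 : ℤ) = η⁻¹ - 1 := by
  have h := integral_zpow (a := η) (b := 1) (n := -2)
    (Or.inr ⟨(by norm_num : (-2 : ℤ) ≠ -1), by
      rw [Set.uIcc_of_le hη1]; exact fun hx ↦ by linarith [hx.1]⟩)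
  rw [h]; norm_num
  ring

/-- A bounded measurable function vanishing off `[a, b]` is integrable. -/
theorem integrable_of_bdd_of_support {E : Type*} [NormedAddCommGroup E] {f : ℝ → E}
    (hf : AEStronglyMeasurable f) {M : ℝ}
    (hM : ∀ x, ‖f x‖ ≤ M) {a b : ℝ} (hsupp : ∀ x, x ∉ Set.Icc a b → f x = 0) :
    Integrable f := by
  have h : IntegrableOn f (Set.Icc a b) :=
    Measure.integrableOn_of_bounded (by simp) hf (Eventually.of_forall fun x ↦ hM x)
  exact h.integrable_of_forall_notMem_eq_zero hsupp

/-- The monomial piece as an indicator. -/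
theorem mono_eq_indicator (ρ : ℂ) (a b : ℝ) :
    mono ρ a b = (Set.Icc a b).indicator (fun x ↦ (x : ℂ) ^ (-ρ)) := by
  ext x
  simp only [mono, Set.indicator_apply, Set.mem_Icc]

/-- `∫ m_{a,b} = (b^{1-ρ} - a^{1-ρ})/(1-ρ)` for `0 < a ≤ b`, `Re ρ = 1/2`. -/
theorem integral_monoPiece (hre : ρ.re = 1 / 2) {a b : ℝ} (hab : a ≤ b) :
    ∫ x, mono ρ a b x = ((b : ℂ) ^ (1 - ρ) - (a : ℂ) ^ (1 - ρ)) / (1 - ρ) := by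
  rw [mono_eq_indicator, integral_indicator measurableSet_Icc, integral_Icc_eq_integral_Ioc,
    ← intervalIntegral.integral_of_le hab, integral_cpow (Or.inl (by rw [neg_re, hre]; norm_num))]
  congr 1 <;> [congr 1 <;> congr 1 <;> ring; ring]

/-- `|𝓕 F(ξ)| ≤ ‖F‖₁`. [folklore] -/
theorem norm_fourier_le_integral_norm (Φ : ℝ → ℂ) (ξ : ℝ) : ‖𝓕 Φ ξ‖ ≤ ∫ x, ‖Φ x‖ := by
  rw [Real.fourier_eq]
  refine (norm_integral_le_integral_norm _).trans (le_of_eq ?_)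
  congr 1 with x
  rw [Circle.norm_smul]

/-- On `(η, 1/2)` the witness is the bare monomial: `‖F_η(x)‖² = x⁻¹`. -/
theorem norm_sq_F_of_mem (hre : ρ.re = 1 / 2) {η : ℝ} (hη : 0 < η) {x : ℝ}
    (hx : x ∈ Set.Ioo η (1 / 2)) : ‖F ρ η x‖ ^ 2 = x⁻¹ := by
  have hx0 : 0 < x := hη.trans hx.1
  rw [F_of_pos hη hx0, G]
  have h1 : mono ρ η 1 x = (x : ℂ) ^ (-ρ) := if_pos ⟨hx.1.le, by linarith [hx.2]⟩
  have h2 : mono ρ (1 / 2) 1 x = 0 := mono_of_not_mem fun h ↦ by linarith [h.1, hx.2]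
  rw [h1, h2, mul_zero, sub_zero, Complex.norm_cpow_eq_rpow_re_of_pos hx0, neg_re, hre,
    ← Real.rpow_natCast, ← Real.rpow_mul hx0.le]
  norm_num
  exact Real.rpow_neg_one x

end LatticeUncertainty

end Summit.RiemannHypothesis.RiemannHypothesis.Theorems
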